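import Summits.QuantumFields.YangMills.Theorems.BalabanLadderUVSeamRecCeilingsPolymerRarityComponents
import Literature.Probability.LatticeModels.LatticeAnimals
import Mathlib.Analysis.SpecificLimits.Basic
import HarnessLib

/-!
# Crux `UVSeamRec` (stmt-QuantumFields-20043), stub `stub_ceilings` (E0′): ENTROPY of the large-field component gas —
# the Peierls sum `Σ_{γ ∋ v connected} δ^{#γ} ≤ 2δ` and the density budget `W` of (PL)

Helper file (`--supports stmt-QuantumFields-20043`) of the width-lever seat `ym-20043-ceilings-p2` (lane B, gen 2); sequel
of p536610 `…CeilingsPolymerRarityComponents.lean` (the scale-zero COMPONENT gas obeys the product law (PL)(iv) for all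
sub-families, weights `δ^{#γ}`).  HONEST FRAMING: combinatorial bookkeeping (any graph of bounded degree); it closes the
DENSITY BUDGET `Σ_γ c_{iγ} w_γ ≤ W` of p527372 / p528131 / p535725 for component gases with `w_γ = δ^{#γ}` once `δ` is
small ((Δ+1)²δ ≤ 1/2), e.g. the scale-zero gas of p536610 at `β ≥ β₀(ε)`; the multiscale gas of Bałaban's regions is
OPEN on odd tori; nothing of E0′; not a gap, not Clay.

* §1 `reflTransGen_reverse`, `cutConnected_of_reflTransGen` — the tree's notion of connectedness
  (`Literature.Probability.LatticeModels.LatticeAnimals`: every point of `γ` is joined to a base point by a chain of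
  adjacencies inside `γ`) implies, for a SYMMETRIC adjacency, the cut-connectedness used by p536610
  (`inter_eq_empty_of_cutConnected`, `productLaw_of_components`).
* §2 **`sum_pow_card_le_two_mul`** — ENTROPY VERSUS ENERGY: for a symmetric adjacency with at most `Δ` neighbours per cell
  and `0 ≤ δ` with `(Δ+1)²·δ ≤ 1/2`, every finite family `𝒮` of connected polymers through a fixed cell `v` has
  `Σ_{γ∈𝒮} δ^{#γ} ≤ 2δ` (the tree's lattice-animal count `card_connectedFamily_le`: at most `(Δ+1)^{2k}` connected sets of
  size `k+1` through `v`; geometric series).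
* §3 **`influenceBudget_le`** — the DENSITY BUDGET: if the influence coefficient of a polymer on a cube is sub-additive over
  its anchor cells, `c_γ ≤ Σ_{v ∈ anchors ∩ γ} κ_v` (`κ ≥ 0`), then `Σ_{γ∈𝒮} c_γ δ^{#γ} ≤ 2δ · Σ_{v∈anchors} κ_v` for every
  finite family `𝒮` of connected polymers — hypothesis `hW` of `integral_exp_mul_sum_influence_le` /
  `responseMoments_of_quadratic_and_polymerLaw` with `W = 2δ Σ_v κ_v` (for the canonical `(b^k/dist)⁴` coefficients on the
  shell of a radius-`R+1` cube at level 0, `Σ_v κ_v ≲ R³·R⁻⁴ ≤ 1`, β-uniform).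

References: S. Friedli, Y. Velenik, *Statistical Mechanics of Lattice Systems* (2017) Lemma 3.38, eq. (5.27) (via the
tree's `LatticeAnimals`); R. Kotecký, D. Preiss, Commun. Math. Phys. 103 (1986) 491–498 (the convergence criterion this
sum feeds); D. Brydges, Les Houches 1984, §2.
-/

set_option autoImplicit false

noncomputable section

open Finset
open Literature.Probability.LatticeModels (card_connectedFamily_le exists_step_out)

namespace Summit.QuantumFields.YangMills.Cruxes.UVSeamRec.PolymerRarity

variable {V : Type*} [DecidableEq V]

/-! ## §1 Chain-connectedness (tree) implies cut-connectedness (p536610) for symmetric adjacencies -/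

omit [DecidableEq V] in
/-- Chains of a symmetric relation reverse. [folklore] -/
theorem reflTransGen_reverse {r : V → V → Prop} (hr : ∀ x y, r x y → r y x) {a b : V}
    (h : Relation.ReflTransGen r a b) : Relation.ReflTransGen r b a := by
  induction h with
  | refl => exact Relation.ReflTransGen.refl
  | tail _ hcd ih => exact Relation.ReflTransGen.head (hr _ _ hcd) ih

/-- **Chain-connected ⇒ cut-connected.**  If every point of the finite set `S` is joined to the base point `v ∈ S` by a
chain of `R`-steps inside `S` (`R` symmetric), then every splitting `S = A ⊔ (S ∖ A)` into nonempty parts is crossed by an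
`R`-step from `A` to `S ∖ A` — the hypothesis `hconn` of p536610's `productLaw_of_components` /
`productLaw_largePlaquetteComponents`. [folklore] -/
theorem cutConnected_of_reflTransGen {R : V → V → Prop} (hR : ∀ x y, R x y → R y x) {S : Finset V} {v : V}
    (hconn : ∀ w ∈ S, Relation.ReflTransGen (fun x y => R x y ∧ x ∈ S ∧ y ∈ S) v w) :
    ∀ A ⊆ S, A.Nonempty → (S \ A).Nonempty → ∃ u ∈ A, ∃ w ∈ S \ A, R u w := by
  intro A hA ⟨a, ha⟩ ⟨s, hs⟩
  have hsS : s ∈ S := (Finset.mem_sdiff.1 hs).1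
  have hsA : s ∉ A := (Finset.mem_sdiff.1 hs).2
  by_cases hvA : v ∈ A
  · obtain ⟨x, y, hx, hy, hyS, hxy⟩ := exists_step_out (hconn s hsS) hvA hsA
    exact ⟨x, hx, y, Finset.mem_sdiff.2 ⟨hyS, hy⟩, hxy⟩
  · -- reverse the chain from `v` to `a ∈ A`: it runs from `A` to `v ∉ A`
    have hsymm : ∀ x y, (R x y ∧ x ∈ S ∧ y ∈ S) → (R y x ∧ y ∈ S ∧ x ∈ S) :=
      fun x y h => ⟨hR x y h.1, h.2.2, h.2.1⟩
    have hav := reflTransGen_reverse hsymm (hconn a (hA ha))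
    obtain ⟨x, y, hx, hy, hyS, hxy⟩ := exists_step_out hav ha hvA
    exact ⟨x, hx, y, Finset.mem_sdiff.2 ⟨hyS, hy⟩, hxy⟩

omit [DecidableEq V] in
/-- Connected from one base point ⇒ connected from every point (symmetric adjacency). [folklore] -/
theorem reflTransGen_of_base {R : V → V → Prop} (hR : ∀ x y, R x y → R y x) {S : Finset V} {b : V}
    (hconn : ∀ w ∈ S, Relation.ReflTransGen (fun x y => R x y ∧ x ∈ S ∧ y ∈ S) b w) {v : V} (hv : v ∈ S) :
    ∀ w ∈ S, Relation.ReflTransGen (fun x y => R x y ∧ x ∈ S ∧ y ∈ S) v w := by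
  intro w hw
  have hsymm : ∀ x y, (R x y ∧ x ∈ S ∧ y ∈ S) → (R y x ∧ y ∈ S ∧ x ∈ S) :=
    fun x y h => ⟨hR x y h.1, h.2.2, h.2.1⟩
  exact (reflTransGen_reverse hsymm (hconn v hv)).trans (hconn w hw)

/-! ## §2 Entropy versus energy: `Σ_{γ ∋ v connected} δ^{#γ} ≤ 2δ` -/

/-- **The Peierls entropy sum.**  Let `R` be a symmetric adjacency on cells with neighbour sets `nbr x ⊇ {y | R x y}` of
size `≤ Δ`, and `0 ≤ δ` with `(Δ+1)²·δ ≤ 1/2`.  Then every finite family `𝒮` of finite cell sets, each containing the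
cell `v` and chain-connected from `v`, satisfies `Σ_{γ∈𝒮} δ^{#γ} ≤ 2δ`.  Proof: group by cardinality `k+1`; the tree's
lattice-animal count gives at most `(Δ+1)^{2k}` members of size `≤ k+1`; `δ Σ_k ((Δ+1)²δ)^k ≤ δ Σ_k 2^{−k} ≤ 2δ`.
[cite: FriedliVelenik2017, Lemma 3.38 and eq. (5.27)] -/
theorem sum_pow_card_le_two_mul {R : V → V → Prop} (hR : ∀ x y, R x y → R y x) {nbr : V → Finset V} {Δ : ℕ}
    (hΔ : ∀ x, (nbr x).card ≤ Δ) (hnbr : ∀ x y, R x y → y ∈ nbr x) (v : V) (𝒮 : Finset (Finset V))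
    (h𝒮 : ∀ S ∈ 𝒮, v ∈ S ∧ ∀ w ∈ S, Relation.ReflTransGen (fun x y => R x y ∧ x ∈ S ∧ y ∈ S) v w)
    {δ : ℝ} (hδ : 0 ≤ δ) (hsmall : ((Δ : ℝ) + 1) ^ 2 * δ ≤ 1 / 2) :
    ∑ S ∈ 𝒮, δ ^ S.card ≤ 2 * δ := by
  -- group the family by cardinality `k + 1`, `k < n + 1`
  set n : ℕ := 𝒮.sup Finset.card with hn
  have hmaps : ∀ S ∈ 𝒮, S.card - 1 ∈ Finset.range (n + 1) := fun S hS =>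
    Finset.mem_range.2 (by have := Finset.le_sup (f := Finset.card) hS; omega)
  have hpos : ∀ S ∈ 𝒮, 1 ≤ S.card := fun S hS => Finset.card_pos.2 ⟨v, (h𝒮 S hS).1⟩
  rw [← Finset.sum_fiberwise_of_maps_to hmaps]
  -- each fibre: at most `(Δ+1)^{2k}` members, each contributing `δ^{k+1}`
  have hfib : ∀ k ∈ Finset.range (n + 1),
      ∑ S ∈ 𝒮.filter (fun S => S.card - 1 = k), δ ^ S.card ≤ ((Δ : ℝ) + 1) ^ (2 * k) * δ ^ (k + 1) := by
    intro k _
    have hval : ∀ S ∈ 𝒮.filter (fun S => S.card - 1 = k), δ ^ S.card = δ ^ (k + 1) := by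
      intro S hS
      obtain ⟨hS𝒮, hSk⟩ := Finset.mem_filter.1 hS
      have : S.card = k + 1 := by have := hpos S hS𝒮; omega
      rw [this]
    rw [Finset.sum_congr rfl hval, Finset.sum_const, nsmul_eq_mul]
    refine mul_le_mul_of_nonneg_right ?_ (by positivity)
    have hcount := card_connectedFamily_le hR hΔ hnbr v k (𝒮.filter fun S => S.card - 1 = k) fun S hS => by
      obtain ⟨hS𝒮, hSk⟩ := Finset.mem_filter.1 hS
      exact ⟨(h𝒮 S hS𝒮).1, by have := hpos S hS𝒮; omega, (h𝒮 S hS𝒮).2⟩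
    exact_mod_cast hcount
  refine (Finset.sum_le_sum hfib).trans ?_
  -- geometric series
  have hq : ∀ k : ℕ, ((Δ : ℝ) + 1) ^ (2 * k) * δ ^ (k + 1) = δ * ((((Δ : ℝ) + 1) ^ 2 * δ) ^ k) := fun k => by
    rw [pow_mul, mul_pow, pow_succ]; ring
  simp_rw [hq]
  rw [← Finset.mul_sum]
  have hgeom : ∑ k ∈ Finset.range (n + 1), (((Δ : ℝ) + 1) ^ 2 * δ) ^ k ≤ 2 :=
    (Finset.sum_le_sum fun k _ => pow_le_pow_left₀ (by positivity) hsmall k).trans (sum_geometric_two_le _)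
  calc δ * ∑ k ∈ Finset.range (n + 1), (((Δ : ℝ) + 1) ^ 2 * δ) ^ k ≤ δ * 2 :=
        mul_le_mul_of_nonneg_left hgeom hδ
    _ = 2 * δ := mul_comm _ _

/-! ## §3 The density budget `W` of (PL) for a component gas -/

/-- **Density budget of a connected-polymer gas.**  Symmetric adjacency with `≤ Δ` neighbours per cell, `0 ≤ δ`,
`(Δ+1)²δ ≤ 1/2`; a finite family `𝒮` of chain-connected polymers; influence coefficients `c γ` that are SUB-ADDITIVE over
anchor cells, `c γ ≤ Σ_{v ∈ anchors, v ∈ γ} κ v` with `κ ≥ 0` (a polymer influences the cube only through the anchor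
cells it contains — for the scale-zero gas: the plaquettes of the cube's boundary shell).  Then
`Σ_{γ∈𝒮} c γ · δ^{#γ} ≤ 2δ · Σ_{v∈anchors} κ v` — the budget `hW` of p527372 `integral_exp_mul_sum_influence_le` and of
p535725 `responseMoments_of_quadratic_and_polymerLaw` for weights `w_γ = δ^{#γ}`.  With shell coefficients
`κ_v ≍ dist(v, x)⁻⁴ ≤ R⁻⁴` over the `≍ R³` boundary plaquettes of a radius-`R+1` cube the right-hand side is `≲ δ/R`,
β- and R-uniform. [folklore] -/
theorem influenceBudget_le {R : V → V → Prop} (hR : ∀ x y, R x y → R y x) {nbr : V → Finset V} {Δ : ℕ}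
    (hΔ : ∀ x, (nbr x).card ≤ Δ) (hnbr : ∀ x y, R x y → y ∈ nbr x) (𝒮 : Finset (Finset V))
    (h𝒮 : ∀ S ∈ 𝒮, ∃ b ∈ S, ∀ w ∈ S, Relation.ReflTransGen (fun x y => R x y ∧ x ∈ S ∧ y ∈ S) b w)
    {δ : ℝ} (hδ : 0 ≤ δ) (hsmall : ((Δ : ℝ) + 1) ^ 2 * δ ≤ 1 / 2)
    (anchors : Finset V) (κ : V → ℝ) (hκ : ∀ v ∈ anchors, 0 ≤ κ v) (c : Finset V → ℝ)
    (hc : ∀ S ∈ 𝒮, c S ≤ ∑ v ∈ anchors.filter (fun v => v ∈ S), κ v) :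
    ∑ S ∈ 𝒮, c S * δ ^ S.card ≤ 2 * δ * ∑ v ∈ anchors, κ v := by
  -- sub-additivity, then exchange the sums
  have h1 : ∑ S ∈ 𝒮, c S * δ ^ S.card ≤ ∑ S ∈ 𝒮, ∑ v ∈ anchors, (if v ∈ S then κ v * δ ^ S.card else 0) := by
    refine Finset.sum_le_sum fun S hS => ?_
    calc c S * δ ^ S.card ≤ (∑ v ∈ anchors.filter (fun v => v ∈ S), κ v) * δ ^ S.card :=
          mul_le_mul_of_nonneg_right (hc S hS) (by positivity)
      _ = ∑ v ∈ anchors, (if v ∈ S then κ v * δ ^ S.card else 0) := by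
          rw [Finset.sum_mul, Finset.sum_filter]
  refine h1.trans ?_
  rw [Finset.sum_comm, Finset.mul_sum]
  refine Finset.sum_le_sum fun v hv => ?_
  -- the polymers through the anchor `v`: entropy sum `≤ 2δ`
  rw [← Finset.sum_filter]
  have h2 : ∑ S ∈ 𝒮.filter (fun S => v ∈ S), κ v * δ ^ S.card = κ v * ∑ S ∈ 𝒮.filter (fun S => v ∈ S), δ ^ S.card := by
    rw [Finset.mul_sum]
  rw [h2]
  have h3 : ∑ S ∈ 𝒮.filter (fun S => v ∈ S), δ ^ S.card ≤ 2 * δ := by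
    refine sum_pow_card_le_two_mul hR hΔ hnbr v _ (fun S hS => ?_) hδ hsmall
    obtain ⟨hS𝒮, hvS⟩ := Finset.mem_filter.1 hS
    obtain ⟨b, hb, hconn⟩ := h𝒮 S hS𝒮
    exact ⟨hvS, reflTransGen_of_base hR hconn hvS⟩
  calc κ v * ∑ S ∈ 𝒮.filter (fun S => v ∈ S), δ ^ S.card ≤ κ v * (2 * δ) :=
        mul_le_mul_of_nonneg_left h3 (hκ v hv)
    _ = 2 * δ * κ v := by ring

end Summit.QuantumFields.YangMills.Cruxes.UVSeamRec.PolymerRarity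

end
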